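import Literature.AnabelianGeometry.AbsoluteAnabelian.MonoidKummerMapsProofs
import HarnessLib

/-!
# Equivariant monoid ENDOMORPHISMS of `𝒪_k̄^⊳` over the identity of `G_k` are power maps

Proof-only companion (theorems only, no definitions) of `MonoidKummerMaps.lean` (abc-iut-L4-t2) and of
abc-iut-L6-t13's `MonoidKummerMapsProofs.lean`; S. Mochizuki, *Topics in Absolute Anabelian Geometry III*,
Def. 3.1 (ii) p. 67 (morphisms of MLF-Galois `TM`-pairs: ANY morphism of topological monoids `φ_M`
compatible with a `φ_Π` inducing an open injection of arithmetic Galois groups), Prop. 3.2 (ii)/(iv) p. 72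
(bib key `MochizukiAbsTopIII2015`, lit key `paper:url-5493eb38cbb7`).

THE POINT.  `MonoidKummerMapsProofs` proves: a `G_k`-equivariant monoid AUTOMORPHISM `α` of the model
`TM`-object `𝒪_k̄^⊳` over the identity of `G_k` is the identity (`MLFClosure.nonzeroIntegers_mulEquiv_eq_self`;
Kummer classes + `⋂ₙ (k(x)ˣ)ⁿ = 1`).  Print's category `𝒞^MLF_TM`, however, has MORE ENDOMORPHISMS over
`id_{G_k}` than automorphisms — e.g. the power maps `(𝟙, x ↦ xᴹ)` (abc-iut-L4-t9 `GaloisMonoidPair.powEnd`,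
finding E-L4-10) — and [AbsTopIII] Prop. 3.2 (ii)'s `μ_Ẑ(G)`-valued Kummer maps are natural along such an
endomorphism exactly when its coefficient square `hsq` holds (abc-iut-w5-d201 p443542; abc-iut-L4-t2
`MonoidKummerGaloisCyclotomeHomComposition` p495791: necessarily `Λ(φ_M^gp)` bijective on `Ẑ(1)`).  This file
CLASSIFIES the endomorphisms: the same Kummer argument, run for a monoid ENDOmorphism (`→*`, no inverse), gives

* `MLFClosure.hom_exists_pow_eq_on_rootsOfUnity` (Step 1), `MLFClosure.hom_exists_kummer_relation` (Step 2):
  the `→*` versions of L6-t13's Steps 1–2 (same proofs — adapted from `MonoidKummerMapsProofs.lean`);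
* `MLFClosure.hom_exists_exponent_congr` (Step 3′): for a uniformiser `ϖ ∈ k`, `α(ϖ) ∈ 𝒪_k ∖ 0` is
  `G_k`-fixed; with `M := ord_k α(ϖ) ≥ 0`, the exponent `m_n` by which `α` acts on `μ_n(k̄)` satisfies
  `m_n ≡ M (mod n)` for EVERY `n` (Kummer relation `α(ϖ) = βⁿ ϖ^{m_n}` read in `k`) — in the automorphism case
  `M = 1` was forced by `α⁻¹`; for an endomorphism `M` is free;
* **`MLFClosure.nonzeroIntegers_monoidHom_eq_pow`** (Step 4′): **`α = (x ↦ xᴹ)`** — for `x ∈ 𝒪_k̄^⊳`,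
  `α(x)/xᴹ = (β xᵗ)ⁿ` lies in `⋂ₙ (k(x)ˣ)ⁿ = 1`, `k(x)` being a non-archimedean local field (abc-iut-L4-t11's
  `FiniteExtension.isNonarchimedeanLocalField`, `GaloisRepresentations.eq_one_of_forall_exists_pow_eq`);
* corollaries `MLFClosure.nonzeroIntegers_monoidHom_eq_powMonoidHom` (as an equality of homomorphisms),
  `…_bijective_iff` (an equivariant endomorphism is bijective iff it is the identity — recovering L6-t13's
  theorem), `…_eq_id_of_fix_rootsOfUnity` (an equivariant endomorphism fixing the roots of unity is `𝟙`).

So `End_{𝒞^MLF_TM}((Π ↷ 𝒪_k̄^⊳))` over `id` is `{(𝟙, x ↦ xᴹ) : M ∈ ℕ}`; the consumer for Prop. 3.2 (ii.4)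
(`hsq` over `id_G` holds iff `M = 1`) is the sibling `MonoidKummerGaloisCyclotomeHomOverId.lean`.

HONEST FRAMING: OUR kernel check of classical Kummer theory over a `p`-adic field (Neukirch, *Algebraic
Number Theory*, Ch. II Prop. 5.7 / Ch. IV §3 for the ingredients); a statement about the cell's typed
category of [AbsTopIII] Def. 3.1; nothing here bears on [IUTchIII] Cor. 3.12; no side is taken; nothing
asserts that abc is proved or refuted.
-/

noncomputable section

open scoped Classical

namespace Literature.AnabelianGeometry.AbsoluteAnabelian

open _root_.ValuativeRel IntermediateField
open Literature.NumberTheory.GaloisRepresentations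

universe u

namespace MLFClosure

variable {C : MLFClosure.{u}}

/-! ## Step 0: equivariance bookkeeping for an endomorphism -/

/-- An equivariant monoid ENDOmorphism `α` of `𝒪_k̄^⊳` over the identity of `G_k` maps `σ`-fixed elements to
`σ`-fixed elements. [cite: MochizukiAbsTopIII2015, Definition 3.1 (ii) p.67] -/
theorem hom_equivariant_apply_eq_of_fixed
    {α : ↥(nonzeroIntegers C.k C.K) →* ↥(nonzeroIntegers C.k C.K)}
    (hα : ∀ (σ : C.K ≃ₐ[C.k] C.K) (x : ↥(nonzeroIntegers C.k C.K)),
      (α ⟨σ • (x : C.K), smul_mem_nonzeroIntegers σ x.2⟩ : C.K) = σ • (α x : C.K))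
    {σ : C.K ≃ₐ[C.k] C.K} {x : ↥(nonzeroIntegers C.k C.K)} (hx : σ (x : C.K) = x) :
    σ (α x : C.K) = α x := by
  have h := hα σ x
  have hsub : (⟨σ • (x : C.K), smul_mem_nonzeroIntegers σ x.2⟩ : ↥(nonzeroIntegers C.k C.K)) = x :=
    Subtype.ext (show σ • (x : C.K) = x by rw [AlgEquiv.smul_def, hx])
  rw [hsub, AlgEquiv.smul_def] at h
  exact h.symm

/-! ## Step 1: roots of unity -/

variable (C) in
/-- STEP 1 (endomorphism version). For `n ≥ 1` there is `m : ℕ` with `α u = u ^ m` for every `u ∈ 𝒪_k̄^⊳` with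
`uⁿ = 1` (`α` maps the cyclic group `μ_n(k̄)` into itself). Adapted from `MonoidKummerMapsProofs.lean`.
[cite: MochizukiAbsTopIII2015, Proposition 3.2 (iv) p.72] -/
theorem hom_exists_pow_eq_on_rootsOfUnity (α : ↥(nonzeroIntegers C.k C.K) →* ↥(nonzeroIntegers C.k C.K))
    {n : ℕ} (hn : 0 < n) :
    ∃ m : ℕ, ∀ u : ↥(nonzeroIntegers C.k C.K), (u : C.K) ^ n = 1 → α u = u ^ m := by
  haveI : IsAlgClosed C.K := IsAlgClosure.isAlgClosed C.k
  haveI : CharZero C.K := charZero_of_injective_algebraMap (algebraMap C.k C.K).injective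
  haveI : NeZero n := ⟨hn.ne'⟩
  obtain ⟨ζ, hζ⟩ := HasEnoughRootsOfUnity.exists_primitiveRoot C.K n
  set u₀ : ↥(nonzeroIntegers C.k C.K) :=
    ⟨ζ, C.mem_nonzeroIntegers_of_pow_eq hn (Submonoid.one_mem _) hζ.pow_eq_one⟩ with hu₀
  have hαu₀ : ((α u₀ : ↥(nonzeroIntegers C.k C.K)) : C.K) ^ n = 1 := by
    have h1 : u₀ ^ n = 1 := Subtype.ext (by
      rw [SubmonoidClass.coe_pow, hu₀]; exact hζ.pow_eq_one)
    have h2 : (α u₀) ^ n = 1 := by rw [← map_pow, h1, map_one]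
    have h3 := congrArg (fun z : ↥(nonzeroIntegers C.k C.K) => (z : C.K)) h2
    simpa using h3
  obtain ⟨m, -, hm⟩ := hζ.eq_pow_of_pow_eq_one hαu₀
  refine ⟨m, fun u hu => ?_⟩
  obtain ⟨i, -, hi⟩ := hζ.eq_pow_of_pow_eq_one hu
  have hu' : u = u₀ ^ i := Subtype.ext (by rw [SubmonoidClass.coe_pow, hu₀]; exact hi.symm)
  have hαu₀' : α u₀ = u₀ ^ m := Subtype.ext (by rw [SubmonoidClass.coe_pow, hu₀]; exact hm.symm)
  rw [hu', map_pow, hαu₀', ← pow_mul, ← pow_mul, mul_comm]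

/-! ## Step 2: the Kummer relation -/

/-- STEP 2 (Kummer, endomorphism version). Let `α` be equivariant and act on `μ_n` by the `m`-th power.  Then for
every `x ∈ 𝒪_k̄^⊳` there is `β ∈ k̄^×`, fixed by every `τ ∈ G_k` fixing `x`, with `α(x) = βⁿ · x^m`.
Adapted from `MonoidKummerMapsProofs.lean`. [cite: MochizukiAbsTopIII2015, Proposition 3.2 (iv) p.72] -/
theorem hom_exists_kummer_relation
    {α : ↥(nonzeroIntegers C.k C.K) →* ↥(nonzeroIntegers C.k C.K)}
    (hα : ∀ (σ : C.K ≃ₐ[C.k] C.K) (x : ↥(nonzeroIntegers C.k C.K)),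
      (α ⟨σ • (x : C.K), smul_mem_nonzeroIntegers σ x.2⟩ : C.K) = σ • (α x : C.K))
    {n m : ℕ} (hn : 0 < n)
    (hm : ∀ u : ↥(nonzeroIntegers C.k C.K), (u : C.K) ^ n = 1 → α u = u ^ m)
    (x : ↥(nonzeroIntegers C.k C.K)) :
    ∃ β : C.K, β ≠ 0 ∧ (∀ τ : C.K ≃ₐ[C.k] C.K, τ (x : C.K) = x → τ β = β) ∧
      (α x : C.K) = β ^ n * (x : C.K) ^ m := by
  haveI : IsAlgClosed C.K := IsAlgClosure.isAlgClosed C.k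
  have hx0 : (x : C.K) ≠ 0 := x.2.2
  obtain ⟨y, hy⟩ := IsAlgClosed.exists_pow_nat_eq (x : C.K) hn
  have hyM : y ∈ nonzeroIntegers C.k C.K := C.mem_nonzeroIntegers_of_pow_eq hn x.2 hy
  have hy0 : y ≠ 0 := hyM.2
  set yM : ↥(nonzeroIntegers C.k C.K) := ⟨y, hyM⟩ with hyMdef
  have hxy : x = yM ^ n := Subtype.ext (by rw [SubmonoidClass.coe_pow, hyMdef]; exact hy.symm)
  set β : C.K := (α yM : C.K) / y ^ m with hβ
  have hαy0 : (α yM : C.K) ≠ 0 := (α yM).2.2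
  have hβ0 : β ≠ 0 := div_ne_zero hαy0 (pow_ne_zero _ hy0)
  refine ⟨β, hβ0, fun τ hτ => ?_, ?_⟩
  · -- `τ y = ζ y` with `ζⁿ = 1`
    set ζ : C.K := τ y / y with hζ
    have hζn : ζ ^ n = 1 := by
      rw [hζ, div_pow, ← map_pow, hy, hτ, div_self hx0]
    have hζM : ζ ∈ nonzeroIntegers C.k C.K :=
      C.mem_nonzeroIntegers_of_pow_eq hn (Submonoid.one_mem _) hζn
    set ζM : ↥(nonzeroIntegers C.k C.K) := ⟨ζ, hζM⟩ with hζMdef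
    have hτy : τ y = ζ * y := by rw [hζ, div_mul_cancel₀ _ hy0]
    have h1 := hα τ yM
    have h2 : (⟨τ • (yM : C.K), smul_mem_nonzeroIntegers τ yM.2⟩ : ↥(nonzeroIntegers C.k C.K)) =
        ζM * yM := Subtype.ext (by
      show τ • y = ζ * y
      rw [AlgEquiv.smul_def, hτy])
    rw [h2, map_mul, hm ζM hζn, AlgEquiv.smul_def] at h1
    have h3 : τ (α yM : C.K) = ζ ^ m * (α yM : C.K) := by
      rw [← h1, Submonoid.coe_mul, SubmonoidClass.coe_pow]
    have hζ0 : ζ ≠ 0 := hζM.2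
    rw [hβ, map_div₀, map_pow, h3, hτy, mul_pow]
    exact mul_div_mul_left _ _ (pow_ne_zero _ hζ0)
  · -- `α x = α (y^n) = (α y)^n = (β y^m)^n = β^n x^m`
    have hαy : (α yM : C.K) = β * y ^ m := by rw [hβ, div_mul_cancel₀ _ (pow_ne_zero _ hy0)]
    rw [hxy, map_pow, SubmonoidClass.coe_pow, hαy, mul_pow, ← pow_mul, SubmonoidClass.coe_pow,
      hyMdef, ← pow_mul, mul_comm m n]

/-! ## Step 3′: the valuation of `k` pins the exponents modulo every `n` -/

/-- The normalised additive valuation of a non-archimedean local field, packaged as data: `ord : k → ℤ`,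
additive on non-zero elements, `≤ 0` on `𝒪_k ∖ 0`, `= -1` at a uniformiser `ϖ ∈ 𝒪_k` (copy of the private
lemma of `MonoidKummerMapsProofs.lean`). Ref: Serre, *Local Fields*, Ch. II §1. [folklore] -/
private theorem exists_ord' (k : Type u) [Field k] [ValuativeRel k] [TopologicalSpace k]
    [IsNonarchimedeanLocalField k] :
    ∃ (ord : k → ℤ) (ϖ : k), ϖ ≠ 0 ∧ ϖ ∈ 𝒪[k] ∧ ord ϖ = -1 ∧
      (∀ a b : k, a ≠ 0 → b ≠ 0 → ord (a * b) = ord a + ord b) ∧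
      (∀ (a : k) (n : ℕ), a ≠ 0 → ord (a ^ n) = n * ord a) ∧
      (∀ a : k, a ≠ 0 → a ∈ 𝒪[k] → ord a ≤ 0) := by
  set e := _root_.IsNonarchimedeanLocalField.valueGroupWithZeroIsoInt k with he
  refine ⟨fun a => WithZero.log (e (valuation k a)), ?_⟩
  obtain ⟨ϖ, hϖ⟩ := exists_units_isUniformizer (F := k)
  have hne : ∀ a : k, a ≠ 0 → e (valuation k a) ≠ 0 := fun a ha h =>
    ((Valuation.ne_zero_iff _).mpr ha) (e.injective (h.trans (map_zero e).symm))
  refine ⟨(ϖ : k), ϖ.ne_zero, le_of_lt hϖ.val_lt_one, ?_, ?_, ?_, ?_⟩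
  · show WithZero.log (e (valuation k (ϖ : k))) = -1
    rw [hϖ.val, IsNonarchimedeanLocalField.valueGroupWithZeroIsoInt_generator, WithZero.log_exp]
  · intro a b ha hb
    show WithZero.log (e (valuation k (a * b))) = WithZero.log (e (valuation k a)) +
      WithZero.log (e (valuation k b))
    rw [map_mul, map_mul, WithZero.log_mul (hne a ha) (hne b hb)]
  · intro a n ha
    show WithZero.log (e (valuation k (a ^ n))) = n * WithZero.log (e (valuation k a))
    rw [map_pow, map_pow, WithZero.log_pow, nsmul_eq_mul]
  · intro a ha hint
    show WithZero.log (e (valuation k a)) ≤ 0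
    rw [WithZero.log_le_iff_le_exp (hne a ha), WithZero.exp_zero, ← map_one e, map_le_map_iff]
    exact hint

/-- An element of `k̄` fixed by every element of `G_k` lies in `k` (infinite Galois theory for `k̄/k`; copy of
the private lemma of `MonoidKummerMapsProofs.lean`). [folklore] -/
private theorem exists_algebraMap_eq_of_fixed' {y : C.K} (hfix : ∀ σ : C.K ≃ₐ[C.k] C.K, σ y = y) :
    ∃ a : C.k, algebraMap C.k C.K a = y := by
  have h : y ∈ IntermediateField.fixedField (⊥ : IntermediateField C.k C.K).fixingSubgroup := by
    rw [IntermediateField.fixingSubgroup_bot, IntermediateField.mem_fixedField_iff]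
    exact fun σ _ => hfix σ
  rw [InfiniteGalois.fixedField_fixingSubgroup, IntermediateField.mem_bot] at h
  exact h

/-- An element of `k̄` fixed by every `τ ∈ G_k` that fixes `x` lies in `k(x)` (infinite Galois correspondence;
copy of the private lemma of `MonoidKummerMapsProofs.lean`). [folklore] -/
private theorem mem_adjoin_of_fixed' {x y : C.K}
    (h : ∀ τ : C.K ≃ₐ[C.k] C.K, τ x = x → τ y = y) :
    y ∈ IntermediateField.adjoin C.k ({x} : Set C.K) := by
  rw [← InfiniteGalois.fixedField_fixingSubgroup (IntermediateField.adjoin C.k ({x} : Set C.K)),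
    IntermediateField.mem_fixedField_iff]
  intro τ hτ
  exact h τ ((IntermediateField.mem_fixingSubgroup_iff _ _).mp hτ x
    (IntermediateField.mem_adjoin_simple_self C.k x))

/-- STEP 3′ (the exponents are congruent to ONE integer `M ≥ 0` modulo every `n`).  Let `α` be an equivariant
monoid endomorphism of `𝒪_k̄^⊳` and `ϖ ∈ k` a uniformiser.  Then `α(ϖ) ∈ 𝒪_k ∖ 0` (it is `G_k`-fixed), and
with `M := ord_k α(ϖ) ≥ 0`: for every `n ≥ 1`, with `α = (·)^m` on `μ_n(k̄)`, the Kummer relation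
`α(ϖ) = βⁿ ϖ^m` (`β ∈ k`) gives `(m : ℤ) = n·t + M`.  (For an automorphism `M = 1`,
`MonoidKummerMapsProofs.exists_exponent_congr_one`; for an endomorphism `M` is free.)
[cite: MochizukiAbsTopIII2015, Proposition 3.2 (iv) p.72] -/
theorem hom_exists_exponent_congr
    {α : ↥(nonzeroIntegers C.k C.K) →* ↥(nonzeroIntegers C.k C.K)}
    (hα : ∀ (σ : C.K ≃ₐ[C.k] C.K) (x : ↥(nonzeroIntegers C.k C.K)),
      (α ⟨σ • (x : C.K), smul_mem_nonzeroIntegers σ x.2⟩ : C.K) = σ • (α x : C.K)) :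
    ∃ M : ℤ, 0 ≤ M ∧ ∀ n : ℕ, 0 < n → ∃ (m : ℕ) (t : ℤ),
      (∀ u : ↥(nonzeroIntegers C.k C.K), (u : C.K) ^ n = 1 → α u = u ^ m) ∧ (m : ℤ) = n * t + M := by
  obtain ⟨ord, ϖ, hϖ0, hϖint, hordϖ, hmul, hpow, hint⟩ := exists_ord' C.k
  have hinj := (algebraMap C.k C.K).injective
  set ϖK : C.K := algebraMap C.k C.K ϖ with hϖK
  have hϖKM : ϖK ∈ nonzeroIntegers C.k C.K :=
    ⟨(isIntegral_algebraMap_iff_mem_integer C.k C.K).mpr hϖint,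
      (map_ne_zero_iff _ hinj).mpr hϖ0⟩
  set P : ↥(nonzeroIntegers C.k C.K) := ⟨ϖK, hϖKM⟩ with hP
  have hPfix : ∀ σ : C.K ≃ₐ[C.k] C.K, σ ϖK = ϖK := fun σ => σ.commutes ϖ
  have hafix : ∀ σ : C.K ≃ₐ[C.k] C.K, σ (α P : C.K) = α P :=
    fun σ => hom_equivariant_apply_eq_of_fixed hα (hPfix σ)
  obtain ⟨a₀, ha₀⟩ := exists_algebraMap_eq_of_fixed' hafix
  have ha₀0 : a₀ ≠ 0 := fun h0 => (α P).2.2 (by rw [← ha₀, h0, map_zero])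
  have ha₀int : a₀ ∈ 𝒪[C.k] :=
    (isIntegral_algebraMap_iff_mem_integer C.k C.K).mp (by rw [ha₀]; exact (α P).2.1)
  refine ⟨-ord a₀, by have := hint a₀ ha₀0 ha₀int; omega, fun N hN => ?_⟩
  obtain ⟨m, hm⟩ := C.hom_exists_pow_eq_on_rootsOfUnity α hN
  -- Kummer for `ϖ`, read in `k`
  obtain ⟨β₁, hβ₁0, hβ₁fix, hβ₁⟩ := hom_exists_kummer_relation hα hN hm P
  obtain ⟨b₁, hb₁⟩ := exists_algebraMap_eq_of_fixed' (fun σ => hβ₁fix σ (hPfix σ))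
  have hb₁0 : b₁ ≠ 0 := fun h0 => hβ₁0 (by rw [← hb₁, h0, map_zero])
  have hrel₁ : a₀ = b₁ ^ N * ϖ ^ m := hinj (by
    rw [ha₀, map_mul, map_pow, map_pow, hb₁]; exact hβ₁)
  have hord₁ : ord a₀ = N * ord b₁ + m * ord ϖ := by
    rw [hrel₁, hmul _ _ (pow_ne_zero _ hb₁0) (pow_ne_zero _ hϖ0), hpow _ _ hb₁0, hpow _ _ hϖ0]
  rw [hordϖ] at hord₁
  exact ⟨m, ord b₁, hm, by linarith⟩

/-! ## Step 4′: conclusion — `α` is a power map -/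

/-- **An equivariant monoid ENDOMORPHISM of `𝒪_k̄^⊳` over the identity of `G_k` is a power map `x ↦ xᴹ`**
(`M = ord_k α(ϖ) ∈ ℕ` for any uniformiser `ϖ` of `k`): the classification of the endomorphisms of the model
`TM`-object of [AbsTopIII] Def. 3.1 (ii) over `id_{G_k}`.  Proof: by Steps 2 and 3′, for `x ∈ 𝒪_k̄^⊳` and every
`n`, `α(x)/xᴹ = (β xᵗ)ⁿ` with `β xᵗ ∈ k(x)`; so `α(x)/xᴹ ∈ ⋂ₙ (k(x)ˣ)ⁿ = 1`, `k(x)` being a non-archimedean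
local field. [cite: MochizukiAbsTopIII2015, Proposition 3.2 (iv) p.72] -/
theorem nonzeroIntegers_monoidHom_eq_pow
    (α : ↥(nonzeroIntegers C.k C.K) →* ↥(nonzeroIntegers C.k C.K))
    (hα : ∀ (σ : C.K ≃ₐ[C.k] C.K) (x : ↥(nonzeroIntegers C.k C.K)),
      (α ⟨σ • (x : C.K), smul_mem_nonzeroIntegers σ x.2⟩ : C.K) = σ • (α x : C.K)) :
    ∃ M : ℕ, ∀ x : ↥(nonzeroIntegers C.k C.K), α x = x ^ M := by
  obtain ⟨M, hM0, hM⟩ := hom_exists_exponent_congr hα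
  refine ⟨M.toNat, fun x => ?_⟩
  have hMnat : ((M.toNat : ℕ) : ℤ) = M := Int.toNat_of_nonneg hM0
  have hx0 : (x : C.K) ≠ 0 := x.2.2
  set E : IntermediateField C.k C.K := IntermediateField.adjoin C.k ({(x : C.K)} : Set C.K) with hE
  have hxk : IsIntegral C.k (x : C.K) := (Algebra.IsAlgebraic.isAlgebraic (x : C.K)).isIntegral
  haveI : FiniteDimensional C.k E := IntermediateField.adjoin.finiteDimensional hxk
  letI := FiniteExtension.valuativeRel C.k E
  letI := FiniteExtension.topologicalSpace C.k E
  haveI := FiniteExtension.isNonarchimedeanLocalField C.k E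
  have hxE : (x : C.K) ∈ E := IntermediateField.mem_adjoin_simple_self C.k (x : C.K)
  have hαxE : (α x : C.K) ∈ E :=
    mem_adjoin_of_fixed' (fun τ hτ => hom_equivariant_apply_eq_of_fixed hα hτ)
  set q : C.K := (α x : C.K) / (x : C.K) ^ M.toNat with hq
  have hq0 : q ≠ 0 := div_ne_zero (α x).2.2 (pow_ne_zero _ hx0)
  have hqE : q ∈ E := div_mem hαxE (pow_mem hxE _)
  -- `q` has `n`-th roots in `E` for every `n`
  have hroots : ∀ n : ℕ, 0 < n → ∃ γ : C.K, γ ∈ E ∧ γ ^ n = q := by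
    intro n hn
    obtain ⟨m, t, hm, hmt⟩ := hM n hn
    obtain ⟨β, hβ0, hβfix, hβ⟩ := hom_exists_kummer_relation hα hn hm x
    have hβE : β ∈ E := mem_adjoin_of_fixed' hβfix
    refine ⟨β * (x : C.K) ^ t, mul_mem hβE (zpow_mem hxE t), ?_⟩
    have hmt' : (m : ℤ) = n * t + (M.toNat : ℕ) := by rw [hMnat]; exact hmt
    have hxm : (x : C.K) ^ m = ((x : C.K) ^ t) ^ n * (x : C.K) ^ M.toNat := by
      rw [← zpow_natCast (x : C.K) m, hmt', zpow_add₀ hx0, zpow_natCast, mul_comm (n : ℤ) t,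
        zpow_mul, zpow_natCast]
    rw [hq, hβ, hxm, mul_pow, ← mul_assoc, mul_div_assoc, div_self (pow_ne_zero _ hx0), mul_one]
  -- in the local field `E`, `⋂ₙ (E^×)ⁿ = 1`
  set qE : E := ⟨q, hqE⟩ with hqEdef
  have hqE0 : qE ≠ 0 := fun h => hq0 (congrArg (fun z : E => (z : C.K)) h)
  have hone : Units.mk0 qE hqE0 = 1 := by
    refine eq_one_of_forall_exists_pow_eq E (Units.mk0 qE hqE0) fun n hn => ?_
    obtain ⟨γ, hγE, hγ⟩ := hroots n hn
    have hγn : (⟨γ, hγE⟩ : E) ^ n = qE := Subtype.ext (by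
      rw [SubmonoidClass.coe_pow]; exact hγ)
    have hγ0 : (⟨γ, hγE⟩ : E) ≠ 0 := by
      intro h0
      rw [h0, zero_pow hn.ne'] at hγn
      exact hqE0 hγn.symm
    exact ⟨Units.mk0 _ hγ0, Units.ext (by simpa using hγn)⟩
  have hq1 : q = 1 := by
    have h := congrArg (fun u : Eˣ => ((u : E) : C.K)) hone
    simpa [hqEdef] using h
  apply Subtype.ext
  have : (α x : C.K) = q * (x : C.K) ^ M.toNat := by rw [hq, div_mul_cancel₀ _ (pow_ne_zero _ hx0)]
  rw [this, hq1, one_mul, SubmonoidClass.coe_pow]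

/-- **The same as an equality of homomorphisms: `α = powMonoidHom M`.**
[cite: MochizukiAbsTopIII2015, Proposition 3.2 (iv) p.72] -/
theorem nonzeroIntegers_monoidHom_eq_powMonoidHom
    (α : ↥(nonzeroIntegers C.k C.K) →* ↥(nonzeroIntegers C.k C.K))
    (hα : ∀ (σ : C.K ≃ₐ[C.k] C.K) (x : ↥(nonzeroIntegers C.k C.K)),
      (α ⟨σ • (x : C.K), smul_mem_nonzeroIntegers σ x.2⟩ : C.K) = σ • (α x : C.K)) :
    ∃ M : ℕ, α = powMonoidHom M := by
  obtain ⟨M, hM⟩ := nonzeroIntegers_monoidHom_eq_pow α hα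
  exact ⟨M, MonoidHom.ext fun x => by rw [hM, powMonoidHom_apply]⟩

/-- `-1 ∈ 𝒪_k̄^⊳`. [folklore] -/
private theorem neg_one_mem_nonzeroIntegers : (-1 : C.K) ∈ nonzeroIntegers C.k C.K :=
  C.mem_nonzeroIntegers_of_pow_eq (n := 2) two_pos (Submonoid.one_mem _) (by norm_num)

/-- `-1 ≠ 1` in `k̄` (characteristic `0`). [folklore] -/
private theorem neg_one_ne_one_K : (-1 : C.K) ≠ 1 := by
  haveI : CharZero C.K := charZero_of_injective_algebraMap (algebraMap C.k C.K).injective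
  intro h
  exact two_ne_zero (by linear_combination -h : (2 : C.K) = 0)

/-- **An equivariant monoid endomorphism of `𝒪_k̄^⊳` over `id_{G_k}` is BIJECTIVE iff it is the IDENTITY** (the
power map `x ↦ xᴹ` is injective on `𝒪_k̄^⊳` only for `M = 1`: `M = 0` identifies `-1` and `1`, `M ≥ 2` kills a
primitive `M`-th root of unity); recovers abc-iut-L6-t13's `nonzeroIntegers_mulEquiv_eq_self`.
[cite: MochizukiAbsTopIII2015, Proposition 3.2 (iv) p.72] -/
theorem nonzeroIntegers_monoidHom_bijective_iff
    (α : ↥(nonzeroIntegers C.k C.K) →* ↥(nonzeroIntegers C.k C.K))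
    (hα : ∀ (σ : C.K ≃ₐ[C.k] C.K) (x : ↥(nonzeroIntegers C.k C.K)),
      (α ⟨σ • (x : C.K), smul_mem_nonzeroIntegers σ x.2⟩ : C.K) = σ • (α x : C.K)) :
    Function.Bijective α ↔ α = MonoidHom.id _ := by
  refine ⟨fun hbij => ?_, fun h => by rw [h]; exact Function.bijective_id⟩
  obtain ⟨M, hM⟩ := nonzeroIntegers_monoidHom_eq_pow α hα
  by_cases hM1 : M = 1
  · subst hM1
    exact MonoidHom.ext fun x => by rw [hM, pow_one, MonoidHom.id_apply]
  exfalso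
  rcases Nat.lt_or_gt_of_ne hM1 with hlt | hgt
  · -- `M = 0`: `α` is constant, `α(-1) = 1 = α(1)`
    have hM0 : M = 0 := by omega
    subst hM0
    have h : (⟨-1, neg_one_mem_nonzeroIntegers⟩ : ↥(nonzeroIntegers C.k C.K)) = 1 :=
      hbij.1 (by rw [hM, hM, pow_zero, pow_zero])
    exact neg_one_ne_one_K (C := C) (by simpa using congrArg Subtype.val h)
  · -- `M ≥ 2`: a primitive `M`-th root of unity `ζ ≠ 1` has `α ζ = ζᴹ = 1 = α 1`
    haveI : IsAlgClosed C.K := IsAlgClosure.isAlgClosed C.k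
    haveI : CharZero C.K := charZero_of_injective_algebraMap (algebraMap C.k C.K).injective
    haveI : NeZero M := ⟨by omega⟩
    obtain ⟨ζ, hζ⟩ := HasEnoughRootsOfUnity.exists_primitiveRoot C.K M
    have hζM : ζ ∈ nonzeroIntegers C.k C.K :=
      C.mem_nonzeroIntegers_of_pow_eq (by omega) (Submonoid.one_mem _) hζ.pow_eq_one
    have h : (⟨ζ, hζM⟩ : ↥(nonzeroIntegers C.k C.K)) = 1 :=
      hbij.1 (by
        rw [hM, hM, one_pow]
        exact Subtype.ext (by rw [SubmonoidClass.coe_pow]; exact hζ.pow_eq_one))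
    exact hζ.ne_one hgt (by simpa using congrArg Subtype.val h)

/-- **An equivariant monoid endomorphism of `𝒪_k̄^⊳` over `id_{G_k}` that fixes the roots of unity is the
identity** (`ζᴹ = ζ` for a primitive `(M+1)`-th root of unity gives `ζ² = 1`, so `M ≤ 1`; `M = 0` would send
`-1 ↦ 1`).  The `→*` analogue of abc-iut-L4-t11's `MLFClosure.submonoid_equivariant_eq_self`.
[cite: MochizukiAbsTopIII2015, Proposition 3.2 (iv) p.72] -/
theorem nonzeroIntegers_monoidHom_eq_id_of_fix_rootsOfUnity
    (α : ↥(nonzeroIntegers C.k C.K) →* ↥(nonzeroIntegers C.k C.K))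
    (hα : ∀ (σ : C.K ≃ₐ[C.k] C.K) (x : ↥(nonzeroIntegers C.k C.K)),
      (α ⟨σ • (x : C.K), smul_mem_nonzeroIntegers σ x.2⟩ : C.K) = σ • (α x : C.K))
    (hfix : ∀ (u : ↥(nonzeroIntegers C.k C.K)) (n : ℕ), 0 < n → (u : C.K) ^ n = 1 → α u = u) :
    α = MonoidHom.id _ := by
  haveI : IsAlgClosed C.K := IsAlgClosure.isAlgClosed C.k
  haveI : CharZero C.K := charZero_of_injective_algebraMap (algebraMap C.k C.K).injective
  obtain ⟨M, hM⟩ := nonzeroIntegers_monoidHom_eq_pow α hα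
  suffices hM1 : M = 1 by
    subst hM1; exact MonoidHom.ext fun x => by rw [hM, pow_one, MonoidHom.id_apply]
  haveI : NeZero (M + 1) := ⟨Nat.succ_ne_zero M⟩
  obtain ⟨ζ, hζ⟩ := HasEnoughRootsOfUnity.exists_primitiveRoot C.K (M + 1)
  have hζmem : ζ ∈ nonzeroIntegers C.k C.K :=
    C.mem_nonzeroIntegers_of_pow_eq (Nat.succ_pos M) (Submonoid.one_mem _) hζ.pow_eq_one
  have h := hfix ⟨ζ, hζmem⟩ (M + 1) (Nat.succ_pos M) hζ.pow_eq_one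
  rw [hM] at h
  have hζM : ζ ^ M = ζ := by
    have := congrArg Subtype.val h
    rwa [SubmonoidClass.coe_pow] at this
  have h2 : ζ ^ 2 = 1 := by
    calc ζ ^ 2 = ζ ^ M * ζ := by rw [pow_two, hζM]
      _ = ζ ^ (M + 1) := by rw [pow_succ]
      _ = 1 := hζ.pow_eq_one
  have hle : M + 1 ≤ 2 := Nat.le_of_dvd two_pos (hζ.dvd_of_pow_eq_one 2 h2)
  rcases Nat.lt_or_ge M 1 with hM0 | hM1
  · exfalso
    have hM0' : M = 0 := by omega
    subst hM0'
    have h1 := hfix ⟨-1, neg_one_mem_nonzeroIntegers⟩ 2 two_pos (by norm_num)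
    rw [hM, pow_zero] at h1
    exact neg_one_ne_one_K (C := C) (by simpa using (congrArg Subtype.val h1).symm)
  · omega

end MLFClosure

end Literature.AnabelianGeometry.AbsoluteAnabelian

end
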